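import Summits.CriticalPhenomena.Ising3DConformalLimit.Theorems.EnergyNotSigmaSquaredMoebiusLimitExistsPedigreeDefs
import HarnessLib

/-!
# Margins of mirror pedigrees are 2-Lipschitz in the configuration
(stub `pedigree_mono` of line `only-interaction-breaks-moebius`, crux `MoebiusLimitExists`,
item stmt-CriticalPhenomena-1344, route `EnergyNotSigmaSquared`)

The locality fact used by the compactness argument of the mirror-pedigree recursion
(`EnergyNotSigmaSquaredMoebiusLimitExistsPedigreeDefs.lean`): if the configuration
`x : Fin n → ℝ³` admits a mirror pedigree of depth `≤ d` with margin `μ` for the moving index `i`,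
then every configuration `x'` with `dist x x' ≤ r` (sup metric) admits THE SAME pedigree (same cuts,
same enumerations, same thresholds) with margin `μ − 2r`.

Ingredients (all elementary):
* a coordinate moves by at most the sup distance (`abs_apply_sub_apply_le_dist_pm`);
* for a cubic direction `g` (entries in `{−1, 0, 1}`, `g·g ≤ 2`) the functional `v ↦ g·v` is
  `2`-Lipschitz for the Euclidean norm (`abs_rdotZ_sub_rdotZ_le_pm`);
* the Euclidean mirror `reflectZ g T` does not increase distances, for every integer direction `g`
  (`dist_reflectZ_reflectZ_le_pm`; for `g = 0` the mirror is the identity by `x / 0 = 0`);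
* hence doubling (`doubledA`) and re-enumeration do not increase the sup distance of
  configurations (`dist_doubledA_doubledA_le_pm`, `dist_comp_equiv_le_pm`);
and an induction over the depth. No definitions are introduced.
-/

noncomputable section

open Filter Topology Set Function Metric
open Literature.Probability.LatticeModels

namespace Summit.CriticalPhenomena.Ising3DConformalLimit.MoebiusLimitExistsOnlyInteraction

/-! ### Metric helpers -/

/-- A single coordinate of a single point moves by at most the sup distance of the
configurations. [folklore] -/
theorem abs_apply_sub_apply_le_dist_pm {n : ℕ} (x x' : Fin n → EuclideanSpace ℝ (Fin 3))
    (j : Fin n) (τ : Fin 3) : |x j τ - x' j τ| ≤ dist x x' := by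
  rw [← Real.dist_eq]
  exact (PiLp.dist_apply_le (x j) (x' j) τ).trans (dist_le_pi_dist x x' j)

/-- For a cubic direction `g` the functional `v ↦ g·v` is `2`-Lipschitz with respect to the
Euclidean distance (`Σ |g j| = g·g ≤ 2`). [folklore] -/
theorem abs_rdotZ_sub_rdotZ_le_pm {g : Site 3} (hg : IsCubicDir g)
    (v w : EuclideanSpace ℝ (Fin 3)) : |rdotZ g v - rdotZ g w| ≤ 2 * dist v w := by
  have hD : ∀ j, |v j - w j| ≤ dist v w := fun j => by
    rw [← Real.dist_eq]
    exact PiLp.dist_apply_le v w j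
  have hterm : ∀ j, |(g j : ℝ) * (v j - w j)| ≤ (g j : ℝ) ^ 2 * dist v w := fun j => by
    rw [abs_mul]
    have habs : |(g j : ℝ)| = (g j : ℝ) ^ 2 := by
      rcases hg.1 j with h | h | h <;> simp [h]
    rw [habs]
    exact mul_le_mul_of_nonneg_left (hD j) (sq_nonneg _)
  have hsum : (g 0 : ℝ) ^ 2 + (g 1 : ℝ) ^ 2 + (g 2 : ℝ) ^ 2 ≤ 2 := by
    have h2 : zdot g g ≤ 2 := by rcases hg.2 with h | h <;> omega
    have h2' : ((zdot g g : ℤ) : ℝ) ≤ 2 := by exact_mod_cast h2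
    have hz : ((zdot g g : ℤ) : ℝ) = (g 0 : ℝ) ^ 2 + (g 1 : ℝ) ^ 2 + (g 2 : ℝ) ^ 2 := by
      simp only [zdot, Int.cast_add, Int.cast_mul, sq]
    rwa [hz] at h2'
  have e : rdotZ g v - rdotZ g w =
      (g 0 : ℝ) * (v 0 - w 0) + (g 1 : ℝ) * (v 1 - w 1) + (g 2 : ℝ) * (v 2 - w 2) := by
    simp only [rdotZ]
    ring
  rw [e]
  calc |(g 0 : ℝ) * (v 0 - w 0) + (g 1 : ℝ) * (v 1 - w 1) + (g 2 : ℝ) * (v 2 - w 2)|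
      ≤ |(g 0 : ℝ) * (v 0 - w 0)| + |(g 1 : ℝ) * (v 1 - w 1)| + |(g 2 : ℝ) * (v 2 - w 2)| :=
        abs_add_three _ _ _
    _ ≤ (g 0 : ℝ) ^ 2 * dist v w + (g 1 : ℝ) ^ 2 * dist v w + (g 2 : ℝ) ^ 2 * dist v w :=
        add_le_add (add_le_add (hterm 0) (hterm 1)) (hterm 2)
    _ = ((g 0 : ℝ) ^ 2 + (g 1 : ℝ) ^ 2 + (g 2 : ℝ) ^ 2) * dist v w := by ring
    _ ≤ 2 * dist v w := mul_le_mul_of_nonneg_right hsum dist_nonneg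

/-- The Euclidean mirror `reflectZ g T` does not increase distances (it is an isometry; for the
degenerate direction `g = 0` it is the identity). [folklore] -/
theorem dist_reflectZ_reflectZ_le_pm (g : Site 3) (T : ℝ) (v w : EuclideanSpace ℝ (Fin 3)) :
    dist (reflectZ g T v) (reflectZ g T w) ≤ dist v w := by
  -- `k` is the common coefficient of `siteVec g` in `reflectZ g T v - reflectZ g T w`
  obtain ⟨k, hk⟩ : ∃ k : ℝ,
      2 * (rdotZ g v - T) / (zdot g g : ℝ) - 2 * (rdotZ g w - T) / (zdot g g : ℝ) = k := ⟨_, rfl⟩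
  have hkey : k * (k * (zdot g g : ℝ) - 2 * (rdotZ g v - rdotZ g w)) = 0 := by
    by_cases hz : (zdot g g : ℝ) = 0
    · have hk0 : k = 0 := by
        rw [← hk, hz]
        simp
      rw [hk0, zero_mul]
    · rw [← hk, ← sub_div, div_mul_cancel₀ _ hz]
      ring
  have hcoord : ∀ j, reflectZ g T v j - reflectZ g T w j = (v j - w j) - k * (g j : ℝ) := by
    intro j
    rw [reflectZ_apply, reflectZ_apply, ← hk]
    ring
  have hz' : ((zdot g g : ℤ) : ℝ) = (g 0 : ℝ) * g 0 + (g 1 : ℝ) * g 1 + (g 2 : ℝ) * g 2 := by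
    simp only [zdot, Int.cast_add, Int.cast_mul]
  rw [hz'] at hkey
  simp only [rdotZ] at hkey
  rw [EuclideanSpace.dist_eq, EuclideanSpace.dist_eq]
  refine Real.sqrt_le_sqrt (le_of_eq ?_)
  simp only [Fin.sum_univ_three, Real.dist_eq, sq_abs, hcoord]
  linear_combination hkey

/-- Doubling a configuration in a mirror does not increase the sup distance. [folklore] -/
theorem dist_doubledA_doubledA_le_pm (g : Site 3) (T : ℝ) {a b : ℕ}
    (x x' : Fin (a + b) → EuclideanSpace ℝ (Fin 3)) :
    dist (doubledA g T x) (doubledA g T x') ≤ dist x x' := by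
  refine (dist_pi_le_iff dist_nonneg).2 fun j => ?_
  refine Fin.addCases (fun j => ?_) (fun j => ?_) j
  · rw [doubledA_left, doubledA_left]
    exact dist_le_pi_dist x x' _
  · rw [doubledA_right, doubledA_right]
    exact (dist_reflectZ_reflectZ_le_pm g T _ _).trans (dist_le_pi_dist x x' _)

/-- Re-enumerating a configuration does not increase the sup distance. [folklore] -/
theorem dist_comp_equiv_le_pm {m n : ℕ} (e : Fin m ≃ Fin n)
    (x x' : Fin n → EuclideanSpace ℝ (Fin 3)) : dist (x ∘ ⇑e) (x' ∘ ⇑e) ≤ dist x x' :=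
  (dist_pi_le_iff dist_nonneg).2 fun j => dist_le_pi_dist x x' (e j)

/-! ### The stub -/

/-- LOCALITY OF MIRROR PEDIGREES: if `x` admits a mirror pedigree of depth `≤ d` with margin `μ`
for the moving index `i` and `dist x x' ≤ r` (sup metric on configurations, Euclidean on `ℝ³`),
then `x'` admits the same pedigree with margin `μ − 2r` (the functional of a cubic cut is
`2`-Lipschitz, mirrors are isometries). [folklore] -/
theorem pedigree_mono :
    ∀ (μ r : ℝ) (d n : ℕ) (x x' : Fin n → EuclideanSpace ℝ (Fin 3)) (i : Fin n),
      PedigreeOK μ d n x i → dist x x' ≤ r → PedigreeOK (μ - 2 * r) d n x' i := by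
  intro μ r d
  induction d with
  | zero =>
    intro n x x' i h hr
    rw [pedigreeOK_zero] at h ⊢
    obtain ⟨τ, hτ⟩ := h
    have hi := abs_le.1 ((abs_apply_sub_apply_le_dist_pm x x' i τ).trans hr)
    refine ⟨τ, ?_⟩
    rcases hτ with hτ | hτ
    · refine Or.inl fun j hj => ?_
      have hj' := abs_le.1 ((abs_apply_sub_apply_le_dist_pm x x' j τ).trans hr)
      linarith [hj'.1, hj'.2, hi.1, hi.2, hτ j hj]
    · refine Or.inr fun j hj => ?_
      have hj' := abs_le.1 ((abs_apply_sub_apply_le_dist_pm x x' j τ).trans hr)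
      linarith [hj'.1, hj'.2, hi.1, hi.2, hτ j hj]
  | succ d ih =>
    intro n x x' i h hr
    rw [pedigreeOK_succ] at h ⊢
    rcases h with h | ⟨g, T, a, b, e, i₀, hg, hi, hA, hB, hped⟩
    · exact Or.inl (ih n x x' i h hr)
    · have hcut : ∀ k : Fin n, |rdotZ g (x k) - rdotZ g (x' k)| ≤ 2 * r := fun k =>
        (abs_rdotZ_sub_rdotZ_le_pm hg (x k) (x' k)).trans
          (mul_le_mul_of_nonneg_left ((dist_le_pi_dist x x' k).trans hr) two_pos.le)
      refine Or.inr ⟨g, T, a, b, e, i₀, hg, hi, fun j => ?_, fun j => ?_, ?_⟩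
      · have h1 := abs_le.1 (hcut (e (Fin.castAdd b j)))
        linarith [h1.1, h1.2, hA j]
      · have h1 := abs_le.1 (hcut (e (Fin.natAdd a j)))
        linarith [h1.1, h1.2, hB j]
      · exact ih (a + a) (doubledA g T (x ∘ ⇑e)) (doubledA g T (x' ∘ ⇑e)) (Fin.castAdd a i₀) hped
          (((dist_doubledA_doubledA_le_pm g T _ _).trans (dist_comp_equiv_le_pm e x x')).trans hr)

end Summit.CriticalPhenomena.Ising3DConformalLimit.MoebiusLimitExistsOnlyInteraction

end
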